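import Summits.NavierStokesRegularity.NavierStokesRegularity.Theorems.HeredityFromTwo.Negative.GlobalSlice
import Summits.NavierStokesRegularity.FluidComputer.PalasekTowerRescaledCopyDelta

/-!
# The GLOBAL-SLICE lever against the LOAD-BEARING stub ALONE: under the robust gate
# `RenormaliseFrom k₀ δ` (`k₀ ≥ 2`) ONE registered copy-stage climbs to every level, so its readout
# slice is an unforced blow-up datum and its design is not globally solvable (kernel, fact-free)

Cell `ns-blowup`, seat `ns-blowup-fc-prover-3` (g5). NEGATIVE-LANE support for the crux item
`PalasekTowerBreakdown.EpisodeInduction` (stmt-NavierStokesRegularity-19178), registered line `fc-oneshot`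
v2.6 (`Cruxes/EpisodeInduction/Lines/fc_oneshot.lean`): stubs `stub_heredityAtOne` (= item 19249),
`stub_gateCopyAtTwo : GateCopyAt 2 (1/3)`, `stub_renormaliseFromThree : RenormaliseFrom 3 (1/3)`
(LOAD-BEARING). This file proves the two sorried TARGETS typed by the line owner (ns-blowup-fc-route g5,
`NEG-TARGET-copy-slice.SKETCH.lean` 0c98b3bc813f98ac, 19178 evidence n40, card note N11) and packages them.

THE POINT. refuter5's slice lever (`HeredityFrom.no_global_slice`, `GlobalSlice.lean`, K5-13) exposes
`HeredityFrom k₀` — for the line: stubs 2 ∧ 3 JOINTLY (`HeredityFromTwo_of`) — to ONE registered stage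
with a globally continuable readout slice; it uses `HeredityFrom k₀` ONLY through
`HeredityFrom.nonempty_stage_all`. Under the robust gate ALONE the same conclusion holds for every
registered COPY-stage (a level-`k` stage, `k ≥ k₀`, whose `τ k`-letter is a `δ`-copy of its
`τ (k-1)`-letter): the gate hands it a continuation that RUNS and carries the next LETTER and a COPY, so
it extends to a registered level-`(k+1)` stage (`Stage.exists_extends_iff_runs_letter`) whose
`τ (k+1)`-letter is again a `δ`-copy (silent-window uniqueness `Stage.continuation_velocity_eq`, levels
`≥ 2`, no named fact) — the induction of `captureAtδ_of_gateCopyAt_renormaliseFrom` started from ONE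
copy-stage instead of from the seed `GateCopyAt k₀ δ`.

* §1 `RenormaliseFrom.exists_extends_copy` (one step), `RenormaliseFrom.exists_copyStage_of_le` (every
  level `≥ k`), **`RenormaliseFrom.nonempty_stage_all_of_copy`** (TARGET 1: up by the copy chain, down by
  `Stage.restrictOfAntitone`), `RenormaliseFrom.exists_realisation_of_copy` (the design realises the tower
  with its own design).
* §2 **`RenormaliseFrom.no_global_copy_slice`** (TARGET 2: the copy-stage's readout slice `s.u (τ k)`
  launches NO global finite-energy classical solution of the UNFORCED system — body of
  `HeredityFrom.no_global_slice` with TARGET 1), packaged `not_renormaliseFrom_of_global_copy_slice`;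
  DESIGN form `RenormaliseFrom.false_of_global_classical_of_copy` / `not_renormaliseFrom_of_global_copy_design`
  and its contrapositive reading **`RenormaliseFrom.not_rescaledCopy_of_global_classical`** (on a globally
  solvable pinned rigid quiet design NO registered letter at a level `≥ k₀` is a `δ`-copy of its
  predecessor: the alphabet is never entered); no-swirl form `RenormaliseFrom.not_axisym_noSwirl_of_copy`;
  Clay-(A) conditional `RenormaliseFrom.false_of_clayA_of_copy_slice_decay`.
* §3 by the line's statement: `palasekTowerBreakdown_not_renormaliseFromThree_of_global_copy_slice` —
  `¬ RenormaliseFrom 3 (1/3)` (the statement of `stub_renormaliseFromThree`) from ONE registered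
  `1/3`-copy-stage at a level `≥ 3` with a globally continuable readout slice; `…_of_global_copy_design`.

LABEL: kernel bookkeeping (E–C typing over landed files; Tao's uniqueness theorems and the lifespan
algebra are theorems of the tree). WHAT THIS IS NOT: not Navier–Stokes evidence either way — nothing is
constructed; no stub is proved or refuted; every premise class below (a REGISTERED copy-stage at a level
`≥ k₀ ≥ 2`) is EMPTY-IN-PRACTICE today (no registered stage at any level `≥ 1` is known: K61 / S-RING-1 /
P-RING-0…2 CLOSED); the lemmas FENCE the design space of the load-bearing stub (designs must keep copy
slices outside globally continuable classes) and refute nothing.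

References: T. Tao, Anal. PDE 6 (2013), Cor. 11.4 [cite: Tao2011, Cor. 11.4]; S. Palasek,
arXiv:2605.13827 §4 [cite: Palasek2026ElementaryModel, §4]; P. G. Lemarié-Rieusset, *The Navier–Stokes
Problem in the 21st Century*, CRC 2016, Thm 10.4 (p. 285) [cite: LemarieRieusset2016, Thm 10.4 (p. 285)];
C. Fefferman, Clay problem description (2006), (A) [cite: FeffermanClay2006, (A)].
-/

noncomputable section

namespace Summit.NavierStokesRegularity.FluidComputer.PalasekTowerClayBridge

open Set MeasureTheory Filter Topology Function
open scoped ENNReal ContDiff NNReal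
open Literature.Analysis.FluidPDE
open Summit.NavierStokesRegularity.NavierStokesRegularity.Theorems

/-! ## §1 Under the robust gate one copy-stage climbs to every level -/

section CopyChain

variable {S : Schedule TowerRates.wide}

/-- **One step of the copy chain** (pointwise form of `CaptureAtδ.succ_of_renormaliseFrom`): under
`RenormaliseFrom k₀ δ`, `k₀ ≥ 2`, a registered level-`k` copy-stage (`k ≥ k₀`) of a pinned rigid quiet
wide design EXTENDS to a registered level-`(k+1)` stage which is again a copy-stage — the gate's
continuation runs and carries the level-`(k+1)` letter (`Stage.exists_extends_iff_runs_letter`), and the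
extension's velocity IS that continuation on `[0, τ (k+1)]` (`Stage.continuation_velocity_eq`), so the
gate's copy clause transfers. [cite: Tao2011, Cor. 11.4] -/
theorem RenormaliseFrom.exists_extends_copy {k₀ : ℕ} {δ : ℝ} (h : RenormaliseFrom k₀ δ) (hk₀ : 2 ≤ k₀)
    (hP : S.Pins 8 (6 / 5)) (hR : S.Rigid) (hQ : S.Quiet) {k : ℕ} (hk : k₀ ≤ k)
    (s : Stage 1 TowerRates.wide S (Margins.routeG TowerRates.wide) k)
    (hc : RescaledCopy S (k - 1) k (s.u (S.τ (k - 1))) (s.u (S.τ k)) δ) :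
    ∃ s' : Stage 1 TowerRates.wide S (Margins.routeG TowerRates.wide) (k + 1),
      s.Extends s' ∧ RescaledCopy S k (k + 1) (s'.u (S.τ k)) (s'.u (S.τ (k + 1))) δ := by
  obtain ⟨u, p, hruns, hletter, hcopy⟩ := h S hP hR hQ k hk s hc
  obtain ⟨s', hs'⟩ := (Stage.exists_extends_iff_runs_letter s).2 ⟨u, p, hruns, hletter⟩
  refine ⟨s', hs', ?_⟩
  obtain ⟨hcl, hagree, henergy, -⟩ := hruns
  have heq : ∀ t ∈ Icc 0 (S.τ (k + 1)), u t = s'.u t :=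
    s.continuation_velocity_eq one_pos hQ (hk₀.trans hk) (S.τ_mono (Nat.le_succ k)) hcl s'.classical
      (fun t ht => (hagree t ht).1) (fun t ht => (hs' t ht).1) henergy s'.energy
  rw [(hs' (S.τ k) ⟨(S.τ_pos k).le, le_rfl⟩).1, ← heq (S.τ (k + 1)) ⟨(S.τ_pos _).le, le_rfl⟩]
  exact hcopy

/-- **The copy chain**: under `RenormaliseFrom k₀ δ`, `k₀ ≥ 2`, one registered level-`k` copy-stage
(`k ≥ k₀`) of a pinned rigid quiet wide design gives a registered copy-stage at every level `m ≥ k`.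
[cite: Tao2011, Cor. 11.4] -/
theorem RenormaliseFrom.exists_copyStage_of_le {k₀ : ℕ} {δ : ℝ} (h : RenormaliseFrom k₀ δ)
    (hk₀ : 2 ≤ k₀) (hP : S.Pins 8 (6 / 5)) (hR : S.Rigid) (hQ : S.Quiet) {k : ℕ} (hk : k₀ ≤ k)
    (s : Stage 1 TowerRates.wide S (Margins.routeG TowerRates.wide) k)
    (hc : RescaledCopy S (k - 1) k (s.u (S.τ (k - 1))) (s.u (S.τ k)) δ) {m : ℕ} (hm : k ≤ m) :
    ∃ s' : Stage 1 TowerRates.wide S (Margins.routeG TowerRates.wide) m,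
      RescaledCopy S (m - 1) m (s'.u (S.τ (m - 1))) (s'.u (S.τ m)) δ := by
  induction m, hm using Nat.le_induction with
  | base => exact ⟨s, hc⟩
  | succ m hm ih =>
    obtain ⟨s', hc'⟩ := ih
    obtain ⟨s'', -, hc''⟩ := h.exists_extends_copy hk₀ hP hR hQ (hk.trans hm) s' hc'
    refine ⟨s'', ?_⟩
    rw [Nat.add_sub_cancel]
    exact hc''

/-- **TARGET 1 — up and down**: under `RenormaliseFrom k₀ δ`, `k₀ ≥ 2`, ONE registered copy-stage at a
level `k ≥ k₀` of a pinned rigid quiet wide design gives a registered stage at EVERY level (up by the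
copy chain, down by `Stage.restrictOfAntitone`, `Margins.antitone_routeG`) — the missing piece against
`HeredityFrom.nonempty_stage_all` (p459058). [cite: Palasek2026ElementaryModel, §4] -/
theorem RenormaliseFrom.nonempty_stage_all_of_copy {k₀ : ℕ} {δ : ℝ} (h : RenormaliseFrom k₀ δ)
    (hk₀ : 2 ≤ k₀) (hP : S.Pins 8 (6 / 5)) (hR : S.Rigid) (hQ : S.Quiet) {k : ℕ} (hk : k₀ ≤ k)
    (s : Stage 1 TowerRates.wide S (Margins.routeG TowerRates.wide) k)
    (hc : RescaledCopy S (k - 1) k (s.u (S.τ (k - 1))) (s.u (S.τ k)) δ) (m : ℕ) :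
    Nonempty (Stage 1 TowerRates.wide S (Margins.routeG TowerRates.wide) m) := by
  obtain ⟨s', -⟩ := h.exists_copyStage_of_le hk₀ hP hR hQ hk s hc (le_max_right m k)
  exact ⟨s'.restrictOfAntitone (Margins.antitone_routeG TowerRates.wide) (le_max_left m k)⟩

/-- **The design of a copy-stage realises the tower WITH ITS OWN DESIGN** under the robust gate
(`Schedule.exists_realisation_of_nonempty_stages`): force `S.f`, datum `S.u₀`, blow-up time `S.T`.
[cite: Palasek2026ElementaryModel, §4] -/
theorem RenormaliseFrom.exists_realisation_of_copy {k₀ : ℕ} {δ : ℝ} (h : RenormaliseFrom k₀ δ)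
    (hk₀ : 2 ≤ k₀) (hP : S.Pins 8 (6 / 5)) (hR : S.Rigid) (hQ : S.Quiet) {k : ℕ} (hk : k₀ ≤ k)
    (s : Stage 1 TowerRates.wide S (Margins.routeG TowerRates.wide) k)
    (hc : RescaledCopy S (k - 1) k (s.u (S.τ (k - 1))) (s.u (S.τ k)) δ) :
    ∃ W : Realisation 1 TowerRates.wide, W.f = S.f ∧ W.u 0 = S.u₀ ∧ W.T = S.T :=
  S.exists_realisation_of_nonempty_stages one_pos (h.nonempty_stage_all_of_copy hk₀ hP hR hQ hk s hc)

end CopyChain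

/-! ## §2 The levers: slice form, design form, no-swirl form, Clay-(A) form -/

section Lever

variable {S : Schedule TowerRates.wide}

/-- **TARGET 2 — under the robust gate every registered COPY-slice is an UNFORCED BLOW-UP DATUM**
(kernel, no named fact, no cap, no symmetry, preparation force unrestricted): given
`RenormaliseFrom k₀ δ`, `k₀ ≥ 2`, and a registered level-`k` copy-stage `s` (`k ≥ k₀`) of a pinned rigid
quiet wide design, the readout slice `s.u (τ k)` has NO classical solution on `[0, ∞)` of the unforced
system with bounded energy. Proof = `HeredityFrom.no_global_slice`'s with
`RenormaliseFrom.nonempty_stage_all_of_copy` for `HeredityFrom.nonempty_stage_all`: the design realises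
the tower, the stage IS the realisation's flow on `[0, τ k]` (forced uniqueness,
`palasekTowerBreakdown_stage_velocity_eq_solution_rates`), the force vanishes from `τ 1 ≤ τ k` on, and
`Realisation.not_global_classical_slice_of_force_zero` applies. [cite: Tao2011, Cor. 11.4]
[cite: Palasek2026ElementaryModel, §4] -/
theorem RenormaliseFrom.no_global_copy_slice {k₀ : ℕ} {δ : ℝ} (h : RenormaliseFrom k₀ δ)
    (hk₀ : 2 ≤ k₀) (hP : S.Pins 8 (6 / 5)) (hR : S.Rigid) (hQ : S.Quiet) {k : ℕ} (hk : k₀ ≤ k)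
    (s : Stage 1 TowerRates.wide S (Margins.routeG TowerRates.wide) k)
    (hc : RescaledCopy S (k - 1) k (s.u (S.τ (k - 1))) (s.u (S.τ k)) δ) :
    ¬ ∃ (v : ℝ → EuclideanSpace ℝ (Fin 3) → EuclideanSpace ℝ (Fin 3))
        (q : ℝ → EuclideanSpace ℝ (Fin 3) → ℝ),
        IsClassicalNSSolutionOn (Ici 0) 1 0 v q ∧ v 0 = s.u (S.τ k) ∧ HasBoundedEnergy v := by
  rintro ⟨v, q, hv, h0, hE⟩
  obtain ⟨W, hWf, hW0, hWT⟩ := h.exists_realisation_of_copy hk₀ hP hR hQ hk s hc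
  -- the stage is the realisation's flow on `[0, τ k]`
  have hτT : S.τ k < W.T := by rw [hWT]; exact S.τ_lt_T k
  set T' : ℝ := (S.τ k + W.T) / 2 with hT'def
  have hT'0 : 0 < T' := by rw [hT'def]; linarith [S.τ_pos k]
  have hT'T : T' < W.T := by rw [hT'def]; linarith
  have hτT' : S.τ k ≤ T' := by rw [hT'def]; linarith
  have hU : IsClassicalNSSolutionOn (Icc 0 T') 1 S.f W.u W.p := by
    rw [← hWf]
    exact W.classical_Icc hT'0 hT'T
  have heq : s.u (S.τ k) = W.u (S.τ k) :=
    palasekTowerBreakdown_stage_velocity_eq_solution_rates one_pos s hτT' hU hW0 (W.energy T' hT'T)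
      (S.τ k) ⟨(S.τ_pos k).le, le_rfl⟩
  -- quiet era: the force vanishes on `[τ k, ∞) ⊆ [τ 1, ∞)`
  have hk1 : 1 ≤ k := le_trans (by norm_num) (hk₀.trans hk)
  have hf : ∀ t : ℝ, S.τ k ≤ t → W.f t = 0 := fun t ht => by
    rw [hWf]
    exact hQ t ((S.τ_mono hk1).trans ht)
  exact W.not_global_classical_slice_of_force_zero one_pos ⟨(S.τ_pos k).le, hτT⟩ hf
    ⟨v, q, hv, h0.trans heq, hE⟩

/-- **The copy-slice lever, packaged** (the form quoted on ns-blowup STATUS l.4913 / card note N11): for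
`k₀ ≥ 2`, ONE pinned rigid quiet wide design with a registered `δ`-copy-stage at a level `k ≥ k₀` whose
readout slice launches a global finite-energy classical solution of the unforced system refutes
`RenormaliseFrom k₀ δ`. Premise empty-in-practice. [cite: Tao2011, Cor. 11.4]
[cite: Palasek2026ElementaryModel, §4] -/
theorem not_renormaliseFrom_of_global_copy_slice {k₀ : ℕ} {δ : ℝ} (hk₀ : 2 ≤ k₀)
    (hW : ∃ (S : Schedule TowerRates.wide) (k : ℕ)
      (s : Stage 1 TowerRates.wide S (Margins.routeG TowerRates.wide) k)
      (v : ℝ → EuclideanSpace ℝ (Fin 3) → EuclideanSpace ℝ (Fin 3))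
      (q : ℝ → EuclideanSpace ℝ (Fin 3) → ℝ),
      k₀ ≤ k ∧ S.Pins 8 (6 / 5) ∧ S.Rigid ∧ S.Quiet ∧
        RescaledCopy S (k - 1) k (s.u (S.τ (k - 1))) (s.u (S.τ k)) δ ∧
        IsClassicalNSSolutionOn (Ici 0) 1 0 v q ∧ v 0 = s.u (S.τ k) ∧ HasBoundedEnergy v) :
    ¬ RenormaliseFrom k₀ δ := by
  rintro h
  obtain ⟨S, k, s, v, q, hk, hP, hR, hQ, hc, hv, h0, hE⟩ := hW
  exact h.no_global_copy_slice hk₀ hP hR hQ hk s hc ⟨v, q, hv, h0, hE⟩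

/-- **DESIGN form — the robust gate + ONE registered copy-stage of a GLOBALLY SOLVABLE design is
absurd**: under `RenormaliseFrom k₀ δ`, `k₀ ≥ 2`, a registered `δ`-copy-stage at a level `k ≥ k₀` of a
pinned rigid quiet wide design whose design `(u₀, f)` has a classical solution on `[0, ∞)` with bounded
energy yields `False` (`Schedule.false_of_nonempty_stages_of_global_classical`; no cap, no symmetry, no
named fact). [cite: Tao2011, Cor. 11.4] [cite: Palasek2026ElementaryModel, §4] -/
theorem RenormaliseFrom.false_of_global_classical_of_copy {k₀ : ℕ} {δ : ℝ} (h : RenormaliseFrom k₀ δ)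
    (hk₀ : 2 ≤ k₀) (hP : S.Pins 8 (6 / 5)) (hR : S.Rigid) (hQ : S.Quiet) {k : ℕ} (hk : k₀ ≤ k)
    (s : Stage 1 TowerRates.wide S (Margins.routeG TowerRates.wide) k)
    (hc : RescaledCopy S (k - 1) k (s.u (S.τ (k - 1))) (s.u (S.τ k)) δ)
    {v : ℝ → EuclideanSpace ℝ (Fin 3) → EuclideanSpace ℝ (Fin 3)}
    {q : ℝ → EuclideanSpace ℝ (Fin 3) → ℝ}
    (hcl : IsClassicalNSSolutionOn (Ici 0) 1 S.f v q) (h0 : v 0 = S.u₀) (hE : HasBoundedEnergy v) :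
    False :=
  S.false_of_nonempty_stages_of_global_classical one_pos
    (h.nonempty_stage_all_of_copy hk₀ hP hR hQ hk s hc) hcl h0 hE

/-- **Contrapositive reading — ON A GLOBALLY SOLVABLE DESIGN THE ALPHABET IS NEVER ENTERED**: under
`RenormaliseFrom k₀ δ`, `k₀ ≥ 2`, if the design `(u₀, f)` of a pinned rigid quiet wide schedule has a
classical solution on `[0, ∞)` with bounded energy, then NO registered stage at a level `k ≥ k₀` has a
`τ k`-letter that is a `δ`-copy of its `τ (k-1)`-letter. [cite: Tao2011, Cor. 11.4]
[cite: Palasek2026ElementaryModel, §4] -/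
theorem RenormaliseFrom.not_rescaledCopy_of_global_classical {k₀ : ℕ} {δ : ℝ}
    (h : RenormaliseFrom k₀ δ) (hk₀ : 2 ≤ k₀) (hP : S.Pins 8 (6 / 5)) (hR : S.Rigid) (hQ : S.Quiet)
    {v : ℝ → EuclideanSpace ℝ (Fin 3) → EuclideanSpace ℝ (Fin 3)}
    {q : ℝ → EuclideanSpace ℝ (Fin 3) → ℝ}
    (hcl : IsClassicalNSSolutionOn (Ici 0) 1 S.f v q) (h0 : v 0 = S.u₀) (hE : HasBoundedEnergy v)
    {k : ℕ} (hk : k₀ ≤ k) (s : Stage 1 TowerRates.wide S (Margins.routeG TowerRates.wide) k) :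
    ¬ RescaledCopy S (k - 1) k (s.u (S.τ (k - 1))) (s.u (S.τ k)) δ :=
  fun hc => h.false_of_global_classical_of_copy hk₀ hP hR hQ hk s hc hcl h0 hE

/-- **The design lever, packaged**: for `k₀ ≥ 2`, ONE pinned rigid quiet wide design with a registered
`δ`-copy-stage at a level `k ≥ k₀` and a globally classically solvable design refutes
`RenormaliseFrom k₀ δ`. Premise empty-in-practice. [cite: Palasek2026ElementaryModel, §4] -/
theorem not_renormaliseFrom_of_global_copy_design {k₀ : ℕ} {δ : ℝ} (hk₀ : 2 ≤ k₀)
    (hW : ∃ (S : Schedule TowerRates.wide) (k : ℕ)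
      (s : Stage 1 TowerRates.wide S (Margins.routeG TowerRates.wide) k)
      (v : ℝ → EuclideanSpace ℝ (Fin 3) → EuclideanSpace ℝ (Fin 3))
      (q : ℝ → EuclideanSpace ℝ (Fin 3) → ℝ),
      k₀ ≤ k ∧ S.Pins 8 (6 / 5) ∧ S.Rigid ∧ S.Quiet ∧
        RescaledCopy S (k - 1) k (s.u (S.τ (k - 1))) (s.u (S.τ k)) δ ∧
        IsClassicalNSSolutionOn (Ici 0) 1 S.f v q ∧ v 0 = S.u₀ ∧ HasBoundedEnergy v) :
    ¬ RenormaliseFrom k₀ δ := by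
  rintro h
  obtain ⟨S, k, s, v, q, hk, hP, hR, hQ, hc, hv, h0, hE⟩ := hW
  exact h.false_of_global_classical_of_copy hk₀ hP hR hQ hk s hc hv h0 hE

/-- **No-swirl form**: under `RenormaliseFrom k₀ δ`, `k₀ ≥ 2`, an UNFORCED (`S.f = 0`) pinned rigid
quiet wide design carrying a registered `δ`-copy-stage at a level `k ≥ k₀` is NOT axisymmetric
swirl-free (Ladyzhenskaya / Ukhovskii–Yudovich, discharged in the tree;
`Schedule.not_axisym_noSwirl_of_nonempty_stages`). [cite: LemarieRieusset2016, Thm 10.4 (p. 285)] -/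
theorem RenormaliseFrom.not_axisym_noSwirl_of_copy {k₀ : ℕ} {δ : ℝ} (h : RenormaliseFrom k₀ δ)
    (hk₀ : 2 ≤ k₀) (hP : S.Pins 8 (6 / 5)) (hR : S.Rigid) (hQ : S.Quiet) (hf : S.f = 0) {k : ℕ}
    (hk : k₀ ≤ k) (s : Stage 1 TowerRates.wide S (Margins.routeG TowerRates.wide) k)
    (hc : RescaledCopy S (k - 1) k (s.u (S.τ (k - 1))) (s.u (S.τ k)) δ) :
    ¬ (IsAxisymmetric S.u₀ ∧ HasNoSwirl S.u₀) :=
  S.not_axisym_noSwirl_of_nonempty_stages one_pos (h.nonempty_stage_all_of_copy hk₀ hP hR hQ hk s hc) hf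

/-- **Clay-(A) form** (conditional bookkeeping; neither side asserted): under Clay (A) and
`RenormaliseFrom k₀ δ`, `k₀ ≥ 2`, no registered `δ`-copy-stage at a level `k ≥ k₀` of a pinned rigid
quiet wide design has a smooth divergence-free RAPIDLY DECAYING readout slice (it would be a Clay datum
with a global smooth bounded-energy unforced solution, against `RenormaliseFrom.no_global_copy_slice`).
[cite: FeffermanClay2006, (A)] -/
theorem RenormaliseFrom.false_of_clayA_of_copy_slice_decay (hA : _root_.NavierStokesRegularity)
    {k₀ : ℕ} {δ : ℝ} (h : RenormaliseFrom k₀ δ) (hk₀ : 2 ≤ k₀) (hP : S.Pins 8 (6 / 5)) (hR : S.Rigid)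
    (hQ : S.Quiet) {k : ℕ} (hk : k₀ ≤ k)
    (s : Stage 1 TowerRates.wide S (Margins.routeG TowerRates.wide) k)
    (hc : RescaledCopy S (k - 1) k (s.u (S.τ (k - 1))) (s.u (S.τ k)) δ)
    (hsm : ContDiff ℝ ∞ (s.u (S.τ k))) (hdiv : NSWave0.IsDivFree (s.u (S.τ k)))
    (hdec : HasRapidSpatialDecay (s.u (S.τ k))) : False := by
  obtain ⟨v, q, hv, hq, hns, hE⟩ := hA 1 one_pos (s.u (S.τ k)) hsm hdiv hdec
  have hcl := isNavierStokesSolution_and_smooth_iff.1 ⟨hns, hv, hq⟩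
  exact h.no_global_copy_slice hk₀ hP hR hQ hk s hc ⟨v, q, hcl.1, hcl.2, hE⟩

end Lever

end Summit.NavierStokesRegularity.FluidComputer.PalasekTowerClayBridge

/-! ## §3 By the registered line's statement (`fc-oneshot` v2.6, stub `stub_renormaliseFromThree`) -/

namespace Summit.NavierStokesRegularity.PalasekTowerBreakdownNegative

open Set
open Summit.NavierStokesRegularity.FluidComputer.PalasekTowerClayBridge
open Literature.Analysis.FluidPDE

/-- **The statement of the load-bearing stub `stub_renormaliseFromThree : RenormaliseFrom 3 (1/3)` ALONE
is refuted by ONE registered stage at a level `k ≥ 3` of a pinned rigid quiet wide design whose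
`τ k`-letter is a `1/3`-copy of its `τ (k-1)`-letter and whose readout slice `s.u (τ k)` launches a
global finite-energy classical solution of the unforced system** — kernel, no named fact, no cap, no
symmetry (`not_renormaliseFrom_of_global_copy_slice` at `(k₀, δ) = (3, 1/3)`). Premise empty-in-practice;
compare `palasekTowerBreakdown_not_heredityFromTwo_of_global_slice` (stubs 2 ∧ 3 jointly, via
`HeredityFromTwo_of`). [cite: Tao2011, Cor. 11.4] [cite: Palasek2026ElementaryModel, §4] -/
theorem palasekTowerBreakdown_not_renormaliseFromThree_of_global_copy_slice
    (hW : ∃ (S : Schedule TowerRates.wide) (k : ℕ)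
      (s : Stage 1 TowerRates.wide S (Margins.routeG TowerRates.wide) k)
      (v : ℝ → EuclideanSpace ℝ (Fin 3) → EuclideanSpace ℝ (Fin 3))
      (q : ℝ → EuclideanSpace ℝ (Fin 3) → ℝ),
      3 ≤ k ∧ S.Pins 8 (6 / 5) ∧ S.Rigid ∧ S.Quiet ∧
        RescaledCopy S (k - 1) k (s.u (S.τ (k - 1))) (s.u (S.τ k)) (1 / 3) ∧
        IsClassicalNSSolutionOn (Ici 0) 1 0 v q ∧ v 0 = s.u (S.τ k) ∧ HasBoundedEnergy v) :
    ¬ RenormaliseFrom 3 (1 / 3) :=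
  not_renormaliseFrom_of_global_copy_slice (by norm_num) hW

/-- **Design form at `(k₀, δ) = (3, 1/3)`**: the statement of `stub_renormaliseFromThree` is refuted by
ONE registered `1/3`-copy-stage at a level `k ≥ 3` of a pinned rigid quiet wide design whose design
`(u₀, f)` is globally classically solvable with bounded energy. Premise empty-in-practice.
[cite: Palasek2026ElementaryModel, §4] -/
theorem palasekTowerBreakdown_not_renormaliseFromThree_of_global_copy_design
    (hW : ∃ (S : Schedule TowerRates.wide) (k : ℕ)
      (s : Stage 1 TowerRates.wide S (Margins.routeG TowerRates.wide) k)
      (v : ℝ → EuclideanSpace ℝ (Fin 3) → EuclideanSpace ℝ (Fin 3))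
      (q : ℝ → EuclideanSpace ℝ (Fin 3) → ℝ),
      3 ≤ k ∧ S.Pins 8 (6 / 5) ∧ S.Rigid ∧ S.Quiet ∧
        RescaledCopy S (k - 1) k (s.u (S.τ (k - 1))) (s.u (S.τ k)) (1 / 3) ∧
        IsClassicalNSSolutionOn (Ici 0) 1 S.f v q ∧ v 0 = S.u₀ ∧ HasBoundedEnergy v) :
    ¬ RenormaliseFrom 3 (1 / 3) :=
  not_renormaliseFrom_of_global_copy_design (by norm_num) hW

/-- **Under the stub's statement every registered `1/3`-copy-slice at a level `k ≥ 3` is an unforced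
blow-up datum** (contrapositive reading: no global finite-energy classical unforced flow from
`s.u (τ k)`). [cite: Tao2011, Cor. 11.4] -/
theorem palasekTowerBreakdown_renormaliseFromThree_no_global_copy_slice (hR3 : RenormaliseFrom 3 (1 / 3))
    {S : Schedule TowerRates.wide} (hP : S.Pins 8 (6 / 5)) (hR : S.Rigid) (hQ : S.Quiet) {k : ℕ}
    (hk : 3 ≤ k) (s : Stage 1 TowerRates.wide S (Margins.routeG TowerRates.wide) k)
    (hc : RescaledCopy S (k - 1) k (s.u (S.τ (k - 1))) (s.u (S.τ k)) (1 / 3)) :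
    ¬ ∃ (v : ℝ → EuclideanSpace ℝ (Fin 3) → EuclideanSpace ℝ (Fin 3))
        (q : ℝ → EuclideanSpace ℝ (Fin 3) → ℝ),
        IsClassicalNSSolutionOn (Ici 0) 1 0 v q ∧ v 0 = s.u (S.τ k) ∧ HasBoundedEnergy v :=
  hR3.no_global_copy_slice (by norm_num) hP hR hQ hk s hc

end Summit.NavierStokesRegularity.PalasekTowerBreakdownNegative

end
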